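import Summits.CriticalPhenomena.PercolationContinuityZ3.Theorems.Transplant.FKConnectivityAllQForestAdjacentDegThree
import HarnessLib

/-!
# The degree-4 HUB: elimination of the common vertex `o` of `e, f` when it meets exactly two further free pairs,
# and the reduction of the square-free adjacent forest Rayleigh node there to ONE 4-terminal inequality on the rest

Support file (`--supports stmt-CriticalPhenomena-4575`), FK sub-lane `prim-bschramm-fk-1` (gen 24) of the post-continuity programme;
builds on p205010 (kernel theorem, internal audit signed; external expert review pending).  No definitions, no named facts, no sorries;
standard axioms.

THE NODE (`AdjForestRayleighNoSqOn`, `…TwoClusterRayleighNoSq.lean`): on every fibre `(M, u₀)` and all `e = ov ≠ f = oy`,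
`#(Fo ∩ {e,f ∈ ω}, Fo) ≤ #(Fo ∩ {e ∈ ω}, Fo ∩ {f ∈ ω})` ("bad ≤ good"); equivalently, in a uniformly random ordered partition of
the edges of a finite multigraph into two forests two edges at a common vertex are more often differently coloured.  It holds at every
vertex of degree ≤ 3 (`…ForestAdjacentDegThree`, fk-1 g18); the first open degree is 4 (memo bschramm/FROM-fk-1-g23-VERTEX-ELIMINATION.md
§4(vi): 71 % of the residual 3-connected Laman-sparse frontier has `deg o = 4`).

THIS FILE (memo bschramm/FROM-fk-1-g24-HUB-EVENT-CALCULUS.md §1–2) eliminates the hub `o` of DEGREE 4.  Guarded fibre `(M, u₀)`: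
`e, f ∉ M ∪ u₀`, and the pairs of `M ∪ u₀` at `o` are exactly `g = oa`, `h = ob`, both free (`∈ M`, `∉ u₀`), `o, v, y, a, b` distinct.
Splitting the configurations by the sides of `g` and `h` (`fibreCount_insert_one` twice) and reading the forest conditions at the then
ISOLATED vertex `o` (`isForestCfg_insert_four_of_isolated` etc.) gives, on the rest `(M₂, u₀) = (M ∖ {g,h}, u₀)` and with
`N(S ‖ T) := #(Fo ∩ {S pairwise separated}, Fo ∩ {T pairwise separated})` (first event on the configuration, second on its partner):
* **`hubFour_bad_eq`**:  `bad  = N(vyab ‖ ·) + N(vya ‖ ·) + N(vyb ‖ ·) + N(vy ‖ ab)`,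
* **`hubFour_good_eq`**: `good = N(vab ‖ ·) + N(va ‖ yb) + N(vb ‖ ya) + N(· ‖ yab)`,
* (companion file `…ForestHubFourNode`) **`adjForestNoSq_guarded_of_hubFour`**, **`adjForestNoSq_fibre_of_hubFour`**: the node's inequality
  at a degree-4 hub follows from the single 4-TERMINAL INEQUALITY (H4) `N(vyab‖·) + N(vya‖·) + N(vyb‖·) + N(vy‖ab) ≤ N(vab‖·) + N(yab‖·) + N(va‖yb) + N(vb‖ya)` on the
  `o`-free rest (the involution `ω ↦ ω ∆ M₂` turns `N(·‖yab)` into `N(yab‖·)`).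
(H4) is the whole content of the node at a degree-4 hub; by inclusion–exclusion it reads `D + 2E_ab + M₁ ≤ 2E_vy + M₂ + M₃`
(`D` = all four separated, `E_p` = `p` the only joined pair, `M₁ = N(vy‖ab)`, `M₂ = N(va‖yb)`, `M₃ = N(vb‖ya)`: "three matchings"),
whose 13 pointwise obstructions are the lineage's 13 hub states (memo §2).  Evidence for (H4) and for the sharper conjecture HUB⁺
`D + 2E_ab + M₁ ≤ M₂ + M₃` (⟺ `good − bad ≥ 2E_vy`; equality-type identity `good − bad = 2E_vy` at degree 3): 0 failures on every
connected rest with ≤ 8 vertices (2.15·10⁶ labelled instances at degree 4; memo §3).  Nothing in this file asserts (H4).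
[cite: SempleWelsh2008, Conj. 1.1 (p. 2); Thm. 4.2 (p. 11)] [cite: CibulkaHladkyLaCroixWagner2008, Thm. 1 (p. 2)] [cite: Linusson2011, Prop. 2.6]
[cite: Grimmett2006, §1.5 (p. 13)]
-/

noncomputable section

namespace Summit.CriticalPhenomena.PercolationContinuityZ3.Theorems
namespace FK

open MeasureTheory Set Literature.Probability.LatticeModels Literature.Probability.Percolation
open scoped Classical symmDiff

variable {V : Type*} [Fintype V]

/-! ### Forest and reachability criteria at an isolated vertex with up to four pendant pairs -/

section Isolated

variable {ω : BondConfig V} {o : V}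

omit [Fintype V] in
/-- Reachability FROM the formerly isolated vertex after inserting a pendant pair `oz` into ANY configuration `ξ ⊇` nothing assumed:
`o ~ x` in `ξ ∪ {oz}` implies `o ~ x` or `z ~ x` in `ξ`. [folklore] -/
theorem reachable_or_of_reachable_insert (ξ : BondConfig V) (z x w : V) (h : (openGraph (insert s(o, z) ξ)).Reachable w x) :
    (openGraph ξ).Reachable w x ∨ ((openGraph ξ).Reachable w o ∧ (openGraph ξ).Reachable z x) ∨
      ((openGraph ξ).Reachable w z ∧ (openGraph ξ).Reachable o x) :=
  (KNSep.reachable_insert_iff ξ o z w x).1 h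

omit [Fintype V] in
/-- With `o` isolated in `ω`: `x ~ w` in `ω ∪ {ob}` iff `x ~ w` in `ω`, for `x, w ≠ o`. [folklore] -/
theorem reachable_insert_one_of_isolated_iff (ho : ∀ p ∈ ω, o ∉ p) {b x w : V} (hx : x ≠ o) (hw : w ≠ o) :
    (openGraph (insert s(o, b) ω)).Reachable x w ↔ (openGraph ω).Reachable x w := by
  rw [KNSep.reachable_insert_iff]
  constructor
  · rintro (h | ⟨h, -⟩ | ⟨-, h⟩)
    · exact h
    · exact absurd h.symm (not_reachable_of_isolated ho hx)
    · exact absurd h (not_reachable_of_isolated ho hw)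
  · exact fun h => Or.inl h

omit [Fintype V] in
/-- **Four pairs at an isolated vertex**: `ω ∪ {ob, oa, ov, oy} ∈ Fo ↔ ω ∈ Fo` and `v, y, a, b` pairwise separated in `ω`
(`o, v, y, a, b` distinct). [cite: CibulkaHladkyLaCroixWagner2008, Thm. 1 (p. 2)] [cite: Grimmett2006, §1.5 (p. 13)] -/
theorem isForestCfg_insert_four_of_isolated (ho : ∀ p ∈ ω, o ∉ p) {v y a b : V} (hov : o ≠ v) (hoy : o ≠ y) (hoa : o ≠ a)
    (hob : o ≠ b) (hvy : v ≠ y) (hva : v ≠ a) (hvb : v ≠ b) (hya : y ≠ a) (hyb : y ≠ b) (hab : a ≠ b) :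
    IsForestCfg (insert s(o, y) (insert s(o, v) (insert s(o, a) (insert s(o, b) ω)))) ↔
      IsForestCfg ω ∧ ¬ (openGraph ω).Reachable v y ∧ ¬ (openGraph ω).Reachable v a ∧ ¬ (openGraph ω).Reachable v b ∧
        ¬ (openGraph ω).Reachable y a ∧ ¬ (openGraph ω).Reachable y b ∧ ¬ (openGraph ω).Reachable a b := by
  constructor
  · intro hF
    -- every 2-star sub-configuration is a forest
    have sub : ∀ {x w : V}, o ≠ x → o ≠ w → x ≠ w →
        insert s(o, w) (insert s(o, x) ω) ⊆ insert s(o, y) (insert s(o, v) (insert s(o, a) (insert s(o, b) ω))) →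
        ¬ (openGraph ω).Reachable x w := by
      intro x w hox how hxw hsub
      have hF' : IsForestCfg (insert s(o, w) (insert s(o, x) ω)) := ⟨fun p hp => hF.1 p (hsub hp), hF.2.anti (openGraph_mono hsub)⟩
      exact ((isForestCfg_insert_two_of_isolated ho hox how hxw).1 hF').2
    have hω : IsForestCfg ω :=
      ⟨fun p hp => hF.1 p (by simp only [mem_insert_iff]; exact Or.inr (Or.inr (Or.inr (Or.inr hp)))),
        hF.2.anti (openGraph_mono fun p hp => by simp only [mem_insert_iff]; exact Or.inr (Or.inr (Or.inr (Or.inr hp))))⟩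
    refine ⟨hω, sub hov hoy hvy ?_, sub hov hoa hva ?_, sub hov hob hvb ?_, sub hoy hoa hya ?_, sub hoy hob hyb ?_,
      sub hoa hob hab ?_⟩ <;>
      (intro p hp; simp only [mem_insert_iff] at hp ⊢; rcases hp with rfl | rfl | hp <;> tauto)
  · rintro ⟨hω, hvy', hva', hvb', hya', hyb', hab'⟩
    set X := insert s(o, v) (insert s(o, a) (insert s(o, b) ω)) with hXdef
    have hX : IsForestCfg X :=
      (isForestCfg_insert_three_of_isolated ho hoa hov hob hva.symm hab hvb).2 ⟨hω, fun h => hva' h.symm, hab', hvb'⟩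
    have hfX : s(o, y) ∉ X := by
      simp only [hXdef, mem_insert_iff, not_or]
      exact ⟨fun h => hvy (Sym2.congr_right.1 h).symm, fun h => hya (Sym2.congr_right.1 h), fun h => hyb (Sym2.congr_right.1 h),
        notMem_of_isolated ho y⟩
    refine (isForestCfg_insert_iff hoy hfX).2 ⟨hX, fun hR => ?_⟩
    -- no path from `o` to `y` in `X`: peel `ov`, then `oa`, then `ob`
    have hyo : y ≠ o := hoy.symm
    have nOY2 : ¬ (openGraph (insert s(o, b) ω)).Reachable o y := fun h => by
      rcases (reachable_insert_of_isolated_iff ho b y).1 h with h | h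
      · exact hyo h
      · exact hyb' h.symm
    have nAY2 : ¬ (openGraph (insert s(o, b) ω)).Reachable a y := fun h =>
      hya' ((reachable_insert_one_of_isolated_iff ho hoa.symm hyo).1 h).symm
    have nVY2 : ¬ (openGraph (insert s(o, b) ω)).Reachable v y := fun h =>
      hvy' ((reachable_insert_one_of_isolated_iff ho hov.symm hyo).1 h)
    have nOY1 : ¬ (openGraph (insert s(o, a) (insert s(o, b) ω))).Reachable o y := fun h => by
      rcases reachable_or_of_reachable_insert _ a y o h with h | ⟨-, h⟩ | ⟨-, h⟩
      · exact nOY2 h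
      · exact nAY2 h
      · exact nOY2 h
    have nVY1 : ¬ (openGraph (insert s(o, a) (insert s(o, b) ω))).Reachable v y := fun h => by
      rcases reachable_or_of_reachable_insert _ a y v h with h | ⟨-, h⟩ | ⟨-, h⟩
      · exact nVY2 h
      · exact nAY2 h
      · exact nOY2 h
    rcases reachable_or_of_reachable_insert _ v y o hR with h | ⟨-, h⟩ | ⟨-, h⟩
    · exact nOY1 h
    · exact nVY1 h
    · exact nOY1 h

end Isolated

/-! ### The degree-4 hub decomposition -/

section HubFour

variable {M u₀ : BondConfig V} {o v y a b : V}

omit [Fintype V] in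
/-- If every pair of `M ∪ u₀` containing `o` is `oa` or `ob`, and neither lies in `W ⊆ M ∪ u₀`, then `o` is isolated in `W`. [folklore] -/
theorem isolated_of_subset_two (hdeg : ∀ p ∈ M ∪ u₀, o ∈ p → p = s(o, a) ∨ p = s(o, b)) {W : BondConfig V} (hsub : W ⊆ M ∪ u₀)
    (hg : s(o, a) ∉ W) (hh : s(o, b) ∉ W) : ∀ p ∈ W, o ∉ p := fun p hp hop => by
  rcases hdeg p (hsub hp) hop with rfl | rfl
  · exact hg hp
  · exact hh hp

/-- **The degree-4 hub decomposition of `bad` and `good`.**  Guarded fibre `(M, u₀)` with `e = ov`, `f = oy` outside `M ∪ u₀`; the pairs of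
`M ∪ u₀` at `o` are exactly the free pairs `g = oa`, `h = ob` (`o, v, y, a, b` distinct).  On the rest `M₂ = M ∖ {g, h}`, writing
`N(S ‖ T) = #_{(M₂,u₀)}(Fo ∩ {S separated}, Fo ∩ {T separated})`:
`bad = N(vyab‖·) + N(vya‖·) + N(vyb‖·) + N(vy‖ab)` and `good = N(vab‖·) + N(va‖yb) + N(vb‖ya) + N(·‖yab)`.
[cite: SempleWelsh2008, Conj. 1.1 (p. 2)] [cite: CibulkaHladkyLaCroixWagner2008, Thm. 1 (p. 2)] [cite: Linusson2011, Prop. 2.6] -/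
theorem hubFour_bad_good_eq (hov : o ≠ v) (hoy : o ≠ y) (hoa : o ≠ a) (hob : o ≠ b) (hvy : v ≠ y) (hva : v ≠ a) (hvb : v ≠ b)
    (hya : y ≠ a) (hyb : y ≠ b) (hab : a ≠ b)
    (heM : s(o, v) ∉ M) (hfM : s(o, y) ∉ M) (heu : s(o, v) ∉ u₀) (hfu : s(o, y) ∉ u₀)
    (hgM : s(o, a) ∈ M) (hhM : s(o, b) ∈ M) (hgu : s(o, a) ∉ u₀) (hhu : s(o, b) ∉ u₀)
    (hdeg : ∀ p ∈ M ∪ u₀, o ∈ p → p = s(o, a) ∨ p = s(o, b)) :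
    fibreCount M u₀ ({ω | s(o, v) ∉ ω ∧ s(o, y) ∉ ω} ∩ {ω | insert s(o, y) (insert s(o, v) ω) ∈ forestEv V})
        ({ω | s(o, v) ∉ ω ∧ s(o, y) ∉ ω} ∩ forestEv V) =
      fibreCount (M \ {s(o, a), s(o, b)}) u₀
          (forestEv V ∩ {ω | ¬ (openGraph ω).Reachable v y ∧ ¬ (openGraph ω).Reachable v a ∧ ¬ (openGraph ω).Reachable v b ∧
            ¬ (openGraph ω).Reachable y a ∧ ¬ (openGraph ω).Reachable y b ∧ ¬ (openGraph ω).Reachable a b}) (forestEv V) +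
        fibreCount (M \ {s(o, a), s(o, b)}) u₀
          (forestEv V ∩ {ω | ¬ (openGraph ω).Reachable v y ∧ ¬ (openGraph ω).Reachable v a ∧ ¬ (openGraph ω).Reachable y a})
          (forestEv V) +
        fibreCount (M \ {s(o, a), s(o, b)}) u₀
          (forestEv V ∩ {ω | ¬ (openGraph ω).Reachable v y ∧ ¬ (openGraph ω).Reachable v b ∧ ¬ (openGraph ω).Reachable y b})
          (forestEv V) +
        fibreCount (M \ {s(o, a), s(o, b)}) u₀ (forestEv V ∩ {ω | ¬ (openGraph ω).Reachable v y})
          (forestEv V ∩ {ω | ¬ (openGraph ω).Reachable a b}) ∧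
    fibreCount M u₀ ({ω | s(o, v) ∉ ω ∧ s(o, y) ∉ ω} ∩ {ω | insert s(o, v) ω ∈ forestEv V})
        ({ω | s(o, v) ∉ ω ∧ s(o, y) ∉ ω} ∩ {ω | insert s(o, y) ω ∈ forestEv V}) =
      fibreCount (M \ {s(o, a), s(o, b)}) u₀
          (forestEv V ∩ {ω | ¬ (openGraph ω).Reachable v a ∧ ¬ (openGraph ω).Reachable v b ∧ ¬ (openGraph ω).Reachable a b})
          (forestEv V) +
        fibreCount (M \ {s(o, a), s(o, b)}) u₀ (forestEv V ∩ {ω | ¬ (openGraph ω).Reachable v a})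
          (forestEv V ∩ {ω | ¬ (openGraph ω).Reachable y b}) +
        fibreCount (M \ {s(o, a), s(o, b)}) u₀ (forestEv V ∩ {ω | ¬ (openGraph ω).Reachable v b})
          (forestEv V ∩ {ω | ¬ (openGraph ω).Reachable y a}) +
        fibreCount (M \ {s(o, a), s(o, b)}) u₀ (forestEv V)
          (forestEv V ∩ {ω | ¬ (openGraph ω).Reachable y a ∧ ¬ (openGraph ω).Reachable y b ∧ ¬ (openGraph ω).Reachable a b}) := by
  set G : Set (BondConfig V) := {ω | s(o, v) ∉ ω ∧ s(o, y) ∉ ω} with hG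
  set M₂ : BondConfig V := M \ {s(o, a), s(o, b)} with hM₂
  have hgh : s(o, a) ≠ s(o, b) := fun h' => hab (Sym2.congr_right.1 h')
  have hgM₂ : s(o, a) ∉ M₂ := fun h' => h'.2 (Or.inl rfl)
  have hhM₂ : s(o, b) ∉ M₂ := fun h' => h'.2 (Or.inr rfl)
  have hg' : s(o, a) ∉ insert s(o, b) M₂ := by
    rw [mem_insert_iff, not_or]; exact ⟨hgh, hgM₂⟩
  have hM : M = insert s(o, a) (insert s(o, b) M₂) := by
    ext p; simp only [hM₂, mem_insert_iff, mem_sdiff, mem_singleton_iff, not_or]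
    constructor
    · intro hp
      by_cases h1 : p = s(o, a)
      · exact Or.inl h1
      · by_cases h2 : p = s(o, b)
        · exact Or.inr (Or.inl h2)
        · exact Or.inr (Or.inr ⟨hp, h1, h2⟩)
    · rintro (rfl | rfl | ⟨hp, -, -⟩)
      · exact hgM
      · exact hhM
      · exact hp
  have hsub₂ : M₂ ∪ u₀ ⊆ M ∪ u₀ := union_subset_union_left _ sdiff_subset
  have hgMu : s(o, a) ∉ M₂ ∪ u₀ := fun h' => h'.elim hgM₂ hgu
  have hhMu : s(o, b) ∉ M₂ ∪ u₀ := fun h' => h'.elim hhM₂ hhu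
  -- e, f differ from g, h and avoid every configuration inside `M ∪ u₀`
  have heg : s(o, v) ≠ s(o, a) := fun h' => hva (Sym2.congr_right.1 h')
  have heh : s(o, v) ≠ s(o, b) := fun h' => hvb (Sym2.congr_right.1 h')
  have hfg : s(o, y) ≠ s(o, a) := fun h' => hya (Sym2.congr_right.1 h')
  have hfh : s(o, y) ≠ s(o, b) := fun h' => hyb (Sym2.congr_right.1 h')
  have hGsub : ∀ W : BondConfig V, W ⊆ M ∪ u₀ → W ∈ G := fun W hW =>
    ⟨fun he => (hW he).elim heM heu, fun hf => (hW hf).elim hfM hfu⟩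
  -- per-configuration facts on the fibre `(M₂, u₀)`
  have facts : ∀ ω : BondConfig V, ω \ M₂ = u₀ →
      (∀ p ∈ ω, o ∉ p) ∧ (∀ p ∈ ω ∆ M₂, o ∉ p) ∧ s(o, a) ∉ ω ∧ s(o, b) ∉ ω ∧ s(o, a) ∉ ω ∆ M₂ ∧ s(o, b) ∉ ω ∆ M₂ ∧
        (∀ W : BondConfig V, W ⊆ insert s(o, a) (insert s(o, b) ω) → W ∈ G) ∧
        (∀ W : BondConfig V, W ⊆ insert s(o, a) (insert s(o, b) (ω ∆ M₂)) → W ∈ G) := by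
    intro ω hω
    have h := subset_union_of_fibre hω
    have hi1 : insert s(o, a) (insert s(o, b) ω) ⊆ M ∪ u₀ :=
      insert_subset (Or.inl hgM) (insert_subset (Or.inl hhM) (h.1.trans hsub₂))
    have hi2 : insert s(o, a) (insert s(o, b) (ω ∆ M₂)) ⊆ M ∪ u₀ :=
      insert_subset (Or.inl hgM) (insert_subset (Or.inl hhM) (h.2.trans hsub₂))
    exact ⟨isolated_of_subset_two hdeg (h.1.trans hsub₂) (fun h' => hgMu (h.1 h')) (fun h' => hhMu (h.1 h')),
      isolated_of_subset_two hdeg (h.2.trans hsub₂) (fun h' => hgMu (h.2 h')) (fun h' => hhMu (h.2 h')),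
      fun h' => hgMu (h.1 h'), fun h' => hhMu (h.1 h'), fun h' => hgMu (h.2 h'), fun h' => hhMu (h.2 h'),
      fun W hW => hGsub W (hW.trans hi1), fun W hW => hGsub W (hW.trans hi2)⟩
  refine ⟨?_, ?_⟩
  · -- bad
    rw [hM, fibreCount_insert_one hg', fibreCount_insert_one hhM₂, fibreCount_insert_one hhM₂]
    have e1 : fibreCount M₂ u₀
        ({ω | s(o, b) ∉ ω} ∩ {ω | insert s(o, b) ω ∈ {ω | s(o, a) ∉ ω} ∩
          {ω | insert s(o, a) ω ∈ G ∩ {ω | insert s(o, y) (insert s(o, v) ω) ∈ forestEv V}}})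
        ({ω | s(o, b) ∉ ω} ∩ ({ω | s(o, a) ∉ ω} ∩ (G ∩ forestEv V))) =
        fibreCount M₂ u₀
          (forestEv V ∩ {ω | ¬ (openGraph ω).Reachable v y ∧ ¬ (openGraph ω).Reachable v a ∧ ¬ (openGraph ω).Reachable v b ∧
            ¬ (openGraph ω).Reachable y a ∧ ¬ (openGraph ω).Reachable y b ∧ ¬ (openGraph ω).Reachable a b}) (forestEv V) := by
      refine fibreCount_congr_fibre M₂ u₀ fun ω hω => ?_
      obtain ⟨iso, isoB, hga, hhb, hgaB, hhbB, hGi, hGiB⟩ := facts ω hω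
      have crit := isForestCfg_insert_four_of_isolated iso hov hoy hoa hob hvy hva hvb hya hyb hab
      constructor
      · rintro ⟨⟨-, -, -, hF⟩, ⟨-, -, -, hFB⟩⟩
        have h4 := crit.1 hF
        exact ⟨⟨h4.1, h4.2⟩, hFB⟩
      · rintro ⟨⟨hF, hs⟩, hFB⟩
        exact ⟨⟨hhb, ⟨fun h' => (mem_insert_iff.1 h').elim hgh hga, hGi _ subset_rfl, crit.2 ⟨hF, hs⟩⟩⟩,
          ⟨hhbB, hgaB, hGiB _ (subset_insert _ _ |>.trans (subset_insert _ _)), hFB⟩⟩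
    have e2 : fibreCount M₂ u₀
        ({ω | s(o, b) ∉ ω} ∩ ({ω | s(o, a) ∉ ω} ∩ {ω | insert s(o, a) ω ∈ G ∩ {ω | insert s(o, y) (insert s(o, v) ω) ∈ forestEv V}}))
        ({ω | s(o, b) ∉ ω} ∩ {ω | insert s(o, b) ω ∈ {ω | s(o, a) ∉ ω} ∩ (G ∩ forestEv V)}) =
        fibreCount M₂ u₀
          (forestEv V ∩ {ω | ¬ (openGraph ω).Reachable v y ∧ ¬ (openGraph ω).Reachable v a ∧ ¬ (openGraph ω).Reachable y a})
          (forestEv V) := by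
      refine fibreCount_congr_fibre M₂ u₀ fun ω hω => ?_
      obtain ⟨iso, isoB, hga, hhb, hgaB, hhbB, hGi, hGiB⟩ := facts ω hω
      have crit := isForestCfg_insert_three_of_isolated iso hov hoy hoa hvy hva hya
      have critB := isForestCfg_insert_of_isolated isoB hob
      constructor
      · rintro ⟨⟨-, -, -, hF⟩, ⟨-, -, -, hFB⟩⟩
        exact ⟨⟨(crit.1 hF).1, (crit.1 hF).2⟩, critB.1 hFB⟩
      · rintro ⟨⟨hF, hs⟩, hFB⟩
        exact ⟨⟨hhb, hga, hGi _ (insert_subset_insert (subset_insert _ _)), crit.2 ⟨hF, hs⟩⟩,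
          ⟨hhbB, ⟨fun h' => (mem_insert_iff.1 h').elim hgh hgaB, hGiB _ (subset_insert _ _), critB.2 hFB⟩⟩⟩
    have e3 : fibreCount M₂ u₀
        ({ω | s(o, b) ∉ ω} ∩ {ω | insert s(o, b) ω ∈ {ω | s(o, a) ∉ ω} ∩ (G ∩ {ω | insert s(o, y) (insert s(o, v) ω) ∈ forestEv V})})
        ({ω | s(o, b) ∉ ω} ∩ ({ω | s(o, a) ∉ ω} ∩ {ω | insert s(o, a) ω ∈ G ∩ forestEv V})) =
        fibreCount M₂ u₀
          (forestEv V ∩ {ω | ¬ (openGraph ω).Reachable v y ∧ ¬ (openGraph ω).Reachable v b ∧ ¬ (openGraph ω).Reachable y b})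
          (forestEv V) := by
      refine fibreCount_congr_fibre M₂ u₀ fun ω hω => ?_
      obtain ⟨iso, isoB, hga, hhb, hgaB, hhbB, hGi, hGiB⟩ := facts ω hω
      have crit := isForestCfg_insert_three_of_isolated iso hov hoy hob hvy hvb hyb
      have critB := isForestCfg_insert_of_isolated isoB hoa
      constructor
      · rintro ⟨⟨-, -, -, hF⟩, ⟨-, -, -, hFB⟩⟩
        exact ⟨⟨(crit.1 hF).1, (crit.1 hF).2⟩, critB.1 hFB⟩
      · rintro ⟨⟨hF, hs⟩, hFB⟩
        exact ⟨⟨hhb, ⟨fun h' => (mem_insert_iff.1 h').elim hgh hga, hGi _ (subset_insert _ _), crit.2 ⟨hF, hs⟩⟩⟩,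
          ⟨hhbB, hgaB, hGiB _ (insert_subset_insert (subset_insert _ _)), critB.2 hFB⟩⟩
    have e4 : fibreCount M₂ u₀
        ({ω | s(o, b) ∉ ω} ∩ ({ω | s(o, a) ∉ ω} ∩ (G ∩ {ω | insert s(o, y) (insert s(o, v) ω) ∈ forestEv V})))
        ({ω | s(o, b) ∉ ω} ∩ {ω | insert s(o, b) ω ∈ {ω | s(o, a) ∉ ω} ∩ {ω | insert s(o, a) ω ∈ G ∩ forestEv V}}) =
        fibreCount M₂ u₀ (forestEv V ∩ {ω | ¬ (openGraph ω).Reachable v y}) (forestEv V ∩ {ω | ¬ (openGraph ω).Reachable a b}) := by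
      refine fibreCount_congr_fibre M₂ u₀ fun ω hω => ?_
      obtain ⟨iso, isoB, hga, hhb, hgaB, hhbB, hGi, hGiB⟩ := facts ω hω
      have crit := isForestCfg_insert_two_of_isolated iso hov hoy hvy
      have critB := isForestCfg_insert_two_of_isolated isoB hob hoa hab.symm
      constructor
      · rintro ⟨⟨-, -, -, hF⟩, ⟨-, -, -, hFB⟩⟩
        exact ⟨⟨(crit.1 hF).1, (crit.1 hF).2⟩, (critB.1 hFB).1, fun h' => (critB.1 hFB).2 h'.symm⟩
      · rintro ⟨⟨hF, hs⟩, hFB, hsB⟩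
        exact ⟨⟨hhb, hga, hGi _ (subset_insert _ _ |>.trans (subset_insert _ _)), crit.2 ⟨hF, hs⟩⟩,
          ⟨hhbB, ⟨fun h' => (mem_insert_iff.1 h').elim hgh hgaB, hGiB _ subset_rfl, critB.2 ⟨hFB, fun h' => hsB h'.symm⟩⟩⟩⟩
    rw [e1, e2, e3, e4]
    ring
  · -- good
    rw [hM, fibreCount_insert_one hg', fibreCount_insert_one hhM₂, fibreCount_insert_one hhM₂]
    have e1 : fibreCount M₂ u₀
        ({ω | s(o, b) ∉ ω} ∩ {ω | insert s(o, b) ω ∈ {ω | s(o, a) ∉ ω} ∩ {ω | insert s(o, a) ω ∈ G ∩ {ω | insert s(o, v) ω ∈ forestEv V}}})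
        ({ω | s(o, b) ∉ ω} ∩ ({ω | s(o, a) ∉ ω} ∩ (G ∩ {ω | insert s(o, y) ω ∈ forestEv V}))) =
        fibreCount M₂ u₀
          (forestEv V ∩ {ω | ¬ (openGraph ω).Reachable v a ∧ ¬ (openGraph ω).Reachable v b ∧ ¬ (openGraph ω).Reachable a b})
          (forestEv V) := by
      refine fibreCount_congr_fibre M₂ u₀ fun ω hω => ?_
      obtain ⟨iso, isoB, hga, hhb, hgaB, hhbB, hGi, hGiB⟩ := facts ω hω
      have crit := isForestCfg_insert_three_of_isolated iso hoa hov hob hva.symm hab hvb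
      have critB := isForestCfg_insert_of_isolated isoB hoy
      constructor
      · rintro ⟨⟨-, -, -, hF⟩, ⟨-, -, -, hFB⟩⟩
        have h3 := crit.1 hF
        exact ⟨⟨h3.1, fun h' => h3.2.1 h'.symm, h3.2.2.2, h3.2.2.1⟩, critB.1 hFB⟩
      · rintro ⟨⟨hF, h1, h2, h3⟩, hFB⟩
        exact ⟨⟨hhb, ⟨fun h' => (mem_insert_iff.1 h').elim hgh hga, hGi _ subset_rfl, crit.2 ⟨hF, fun h' => h1 h'.symm, h3, h2⟩⟩⟩,
          ⟨hhbB, hgaB, hGiB _ (subset_insert _ _ |>.trans (subset_insert _ _)), critB.2 hFB⟩⟩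
    have e2 : fibreCount M₂ u₀
        ({ω | s(o, b) ∉ ω} ∩ ({ω | s(o, a) ∉ ω} ∩ {ω | insert s(o, a) ω ∈ G ∩ {ω | insert s(o, v) ω ∈ forestEv V}}))
        ({ω | s(o, b) ∉ ω} ∩ {ω | insert s(o, b) ω ∈ {ω | s(o, a) ∉ ω} ∩ (G ∩ {ω | insert s(o, y) ω ∈ forestEv V})}) =
        fibreCount M₂ u₀ (forestEv V ∩ {ω | ¬ (openGraph ω).Reachable v a}) (forestEv V ∩ {ω | ¬ (openGraph ω).Reachable y b}) := by
      refine fibreCount_congr_fibre M₂ u₀ fun ω hω => ?_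
      obtain ⟨iso, isoB, hga, hhb, hgaB, hhbB, hGi, hGiB⟩ := facts ω hω
      have crit := isForestCfg_insert_two_of_isolated iso hoa hov hva.symm
      have critB := isForestCfg_insert_two_of_isolated isoB hob hoy hyb.symm
      constructor
      · rintro ⟨⟨-, -, -, hF⟩, ⟨-, -, -, hFB⟩⟩
        exact ⟨⟨(crit.1 hF).1, fun h' => (crit.1 hF).2 h'.symm⟩, (critB.1 hFB).1, fun h' => (critB.1 hFB).2 h'.symm⟩
      · rintro ⟨⟨hF, hs⟩, hFB, hsB⟩
        exact ⟨⟨hhb, hga, hGi _ (insert_subset_insert (subset_insert _ _)), crit.2 ⟨hF, fun h' => hs h'.symm⟩⟩,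
          ⟨hhbB, ⟨fun h' => (mem_insert_iff.1 h').elim hgh hgaB, hGiB _ (subset_insert _ _), critB.2 ⟨hFB, fun h' => hsB h'.symm⟩⟩⟩⟩
    have e3 : fibreCount M₂ u₀
        ({ω | s(o, b) ∉ ω} ∩ {ω | insert s(o, b) ω ∈ {ω | s(o, a) ∉ ω} ∩ (G ∩ {ω | insert s(o, v) ω ∈ forestEv V})})
        ({ω | s(o, b) ∉ ω} ∩ ({ω | s(o, a) ∉ ω} ∩ {ω | insert s(o, a) ω ∈ G ∩ {ω | insert s(o, y) ω ∈ forestEv V}})) =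
        fibreCount M₂ u₀ (forestEv V ∩ {ω | ¬ (openGraph ω).Reachable v b}) (forestEv V ∩ {ω | ¬ (openGraph ω).Reachable y a}) := by
      refine fibreCount_congr_fibre M₂ u₀ fun ω hω => ?_
      obtain ⟨iso, isoB, hga, hhb, hgaB, hhbB, hGi, hGiB⟩ := facts ω hω
      have crit := isForestCfg_insert_two_of_isolated iso hob hov hvb.symm
      have critB := isForestCfg_insert_two_of_isolated isoB hoa hoy hya.symm
      constructor
      · rintro ⟨⟨-, -, -, hF⟩, ⟨-, -, -, hFB⟩⟩
        exact ⟨⟨(crit.1 hF).1, fun h' => (crit.1 hF).2 h'.symm⟩, (critB.1 hFB).1, fun h' => (critB.1 hFB).2 h'.symm⟩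
      · rintro ⟨⟨hF, hs⟩, hFB, hsB⟩
        exact ⟨⟨hhb, ⟨fun h' => (mem_insert_iff.1 h').elim hgh hga, hGi _ (subset_insert _ _), crit.2 ⟨hF, fun h' => hs h'.symm⟩⟩⟩,
          ⟨hhbB, hgaB, hGiB _ (insert_subset_insert (subset_insert _ _)), critB.2 ⟨hFB, fun h' => hsB h'.symm⟩⟩⟩
    have e4 : fibreCount M₂ u₀
        ({ω | s(o, b) ∉ ω} ∩ ({ω | s(o, a) ∉ ω} ∩ (G ∩ {ω | insert s(o, v) ω ∈ forestEv V})))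
        ({ω | s(o, b) ∉ ω} ∩ {ω | insert s(o, b) ω ∈ {ω | s(o, a) ∉ ω} ∩ {ω | insert s(o, a) ω ∈ G ∩ {ω | insert s(o, y) ω ∈ forestEv V}}}) =
        fibreCount M₂ u₀ (forestEv V)
          (forestEv V ∩ {ω | ¬ (openGraph ω).Reachable y a ∧ ¬ (openGraph ω).Reachable y b ∧ ¬ (openGraph ω).Reachable a b}) := by
      refine fibreCount_congr_fibre M₂ u₀ fun ω hω => ?_
      obtain ⟨iso, isoB, hga, hhb, hgaB, hhbB, hGi, hGiB⟩ := facts ω hω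
      have crit := isForestCfg_insert_of_isolated iso hov
      have critB := isForestCfg_insert_three_of_isolated isoB hoa hoy hob hya.symm hab hyb
      constructor
      · rintro ⟨⟨-, -, -, hF⟩, ⟨-, -, -, hFB⟩⟩
        have h3 := critB.1 hFB
        exact ⟨crit.1 hF, h3.1, fun h' => h3.2.1 h'.symm, h3.2.2.2, h3.2.2.1⟩
      · rintro ⟨hF, hFB, h1, h2, h3⟩
        exact ⟨⟨hhb, hga, hGi _ (subset_insert _ _ |>.trans (subset_insert _ _)), crit.2 hF⟩,
          ⟨hhbB, ⟨fun h' => (mem_insert_iff.1 h').elim hgh hgaB, hGiB _ subset_rfl, critB.2 ⟨hFB, fun h' => h1 h'.symm, h3, h2⟩⟩⟩⟩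
    rw [e1, e2, e3, e4]
    ring

end HubFour

end FK
end Summit.CriticalPhenomena.PercolationContinuityZ3.Theorems

end
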